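import Summits.MatrixMultiplication.MatrixMultiplication.Theses.NilCoxeterShadow

/-!
# Route NilCoxeterShadow — assembly item `Assembly` (stmt-MatrixMultiplication-10388)

`AThesis → DegenerationTransfer → OmegaTwoGroupAlgebraRank → ¬ MatrixMultiplication`:
the thesis X_NC (`bR(T_{NC_n}) ≥ (n!)^{1+δ}` infinitely often) together with the two support
items (`bR(T_{NC_n}) ≤ R(T_{ℂ[S_n]})` and `ω(ℂ) = 2 → R(T_{ℂ[G]}) ≤ C_ε |G|^{1+ε}`) refutes
`ω(ℂ) = 2`. This is literally the type of the route's deciding theorem `closes`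
(at `ε = δ/2`: `(n!)^{δ/2} ≤ C` infinitely often is absurd since `n! → ∞`), so the item is
discharged by applying it.
-/

-- the tree's namespace `Summit.MatrixMultiplication.MatrixMultiplication.…` repeats a component by design
set_option linter.dupNamespace false

namespace Summit.MatrixMultiplication.MatrixMultiplication.Theorems

/-- Assembly of route NilCoxeterShadow (item stmt-MatrixMultiplication-10388): the thesis `AThesis`
and the support items `DegenerationTransfer`, `OmegaTwoGroupAlgebraRank` together refute
`MatrixMultiplication` (`ω(ℂ) = 2`) — by the route's deciding theorem `closes`. -/
theorem nilCoxeterShadow_assembly_proof :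
    Summit.MatrixMultiplication.MatrixMultiplication.Theses.NilCoxeterShadow.Assembly := by
  unfold Summit.MatrixMultiplication.MatrixMultiplication.Theses.NilCoxeterShadow.Assembly
  exact fun hT hD hO =>
    Summit.MatrixMultiplication.MatrixMultiplication.Theses.NilCoxeterShadow.closes hT hD hO

end Summit.MatrixMultiplication.MatrixMultiplication.Theorems
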